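import Mathlib
import HarnessLib
import Summits.ValiantsHypothesis.ValiantsHypothesis.Theorems.MonotoneRestorationOrbitRestorationQPSplit
import Summits.ValiantsHypothesis.ValiantsHypothesis.Theorems.MonotoneRestorationOrbitRestorationQPCloseOrbit

/-!
# Route MonotoneRestoration — crux `OrbitRestorationQP` (stmt-ValiantsHypothesis-18293): the counting-width
# split with its orbit stub DISCHARGED

`orbitRestorationQP_of_narrowExpansion` (`Theorems/MonotoneRestorationOrbitRestorationQPSplit.lean`, the typed
split of line `narrow-expansion`) reads `NarrowExpansionVP → HomPolyClose → CloseOrbit → OrbitRestorationQP`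
with the three sub-crux statements spelled out.  The third, `CloseOrbit` = `stub_close_orbit` — the closed
polynomial of a labelled pattern expression with `k + l` labels has, at every order `n` and WHATEVER ITS
LENGTH, a square-symmetric circuit all of whose Dawar–Wilsenach gate orbits have size `≤ (n+1)^(k+l+2)` —
is now a THEOREM (`stub_close_orbit`, `Theorems/MonotoneRestorationOrbitRestorationQPCloseOrbit.lean`: the
reduced circuit of the universe of normal unfoldings; rigid by `Literature/…/SymmetricCircuitRigidity.lean`).
Hence the crux follows from the two remaining statements:

* `NarrowExpansionVP` (K1, conjecture-grade — the content: every matrix-symmetric `VP` family lies, for every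
  `n`, in the `ℂ`-span of homomorphism polynomials of bipartite patterns of treewidth `≤ (log₂ n + c)^c`);
* `HomPolyClose` (K2, folklore, provable: a pattern of treewidth `≤ w` is, for `n ≥ 1` and `k, l ≥ w + 1`,
  the closed polynomial of a labelled pattern expression — Lovász / Dell–Grohe–Rattan).

VP ≠ VNP is not moved: the crux stays open (K1 is its content).
-/

noncomputable section

-- `Summit.ValiantsHypothesis.ValiantsHypothesis.…` is the tree's single-conjunct layout (Sub = Summit).
set_option linter.dupNamespace false

namespace Summit.ValiantsHypothesis.ValiantsHypothesis.Theorems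

open Literature.Computability.AlgebraicComplexity

/-- **The counting-width route to the crux, orbit stub discharged**:
`NarrowExpansionVP → HomPolyClose → OrbitRestorationQP` (statements verbatim as in
`orbitRestorationQP_of_narrowExpansion`, whose third hypothesis is supplied by the theorem
`stub_close_orbit`). [folklore] -/
theorem orbitRestorationQP_of_narrowExpansion_of_homPolyClose :
    (∀ f : (n : ℕ) → MvPolynomial (Fin n × Fin n) ℂ,
      (∀ (n : ℕ) (σ τ : Equiv.Perm (Fin n)),
        MvPolynomial.rename (fun p : Fin n × Fin n => (σ p.1, τ p.2)) (f n) = f n) →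
      IsVPFamily f →
      ∃ c : ℕ, ∀ n : ℕ, f n ∈ Submodule.span ℂ
        {p : MvPolynomial (Fin n × Fin n) ℂ | ∃ (a b : ℕ) (E : Multiset (Fin a × Fin b)),
          Literature.Combinatorics.SimpleGraph.treewidth
              (SimpleGraph.fromRel fun u v : Fin a ⊕ Fin b =>
                ∃ e ∈ E, u = Sum.inl e.1 ∧ v = Sum.inr e.2) ≤ (Nat.log 2 n + c) ^ c ∧
            p = homPoly E n ℂ}) →
    (∀ (a b w : ℕ) (E : Multiset (Fin a × Fin b)),
      Literature.Combinatorics.SimpleGraph.treewidth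
          (SimpleGraph.fromRel fun u v : Fin a ⊕ Fin b =>
            ∃ e ∈ E, u = Sum.inl e.1 ∧ v = Sum.inr e.2) ≤ w →
      ∀ n : ℕ, 1 ≤ n → ∀ k l : ℕ, w + 1 ≤ k → w + 1 ≤ l →
        ∃ e : PatternExpr ℂ k l, e.close n = homPoly E n ℂ) →
    Summit.ValiantsHypothesis.ValiantsHypothesis.Theses.MonotoneRestoration.OrbitRestorationQP :=
  fun h₁ h₂ => orbitRestorationQP_of_narrowExpansion h₁ h₂ stub_close_orbit

end Summit.ValiantsHypothesis.ValiantsHypothesis.Theorems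

end
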